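import Summits.Ventures.QEC.Census.BB.S8_126_w6_k12_01061B01.AutsA
import Summits.Ventures.QEC.Census.BB.S8_126_w6_k12_01061B01.AutsB
import HarnessLib

set_option Elab.async false
set_option maxRecDepth 200000

/-!
# `[[252,12,16]]` one-level cover certificate of `S8_126_w6_k12_01061B01` — ASSEMBLY side: `hauts : autsCompatOK cov hx hz perms ePermqs rowss rowss`
(collector over `AutsA`/`AutsB`; `CertCoverProducers.autsCompatOK_of_forallL`). Theorems only; KERNEL. qec-search-1 g5.
-/

namespace Summit.Ventures.QEC.Census.S8_126_w6_k12_01061B01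

open Matrix Summit.Ventures.QEC.Census Literature.InformationTheory.QuantumCodes

/-- **`hauts`**: the automorphism tables of T1 (63 translations, index `i ↔ (i / 1, i % 1)`). -/
theorem hauts : autsCompatOK S8_126_w6_k12_01061B01.cov hx hz perms ePermqs rowss rowss = true := by
  refine autsCompatOK_of_forallL (by decide) fun i hi => ?_
  have hi' : i < 63 := by simpa [perms] using hi
  interval_cases i
  · exact aut0_ok
  · exact aut1_ok
  · exact aut2_ok
  · exact aut3_ok
  · exact aut4_ok
  · exact aut5_ok
  · exact aut6_ok
  · exact aut7_ok
  · exact aut8_ok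
  · exact aut9_ok
  · exact aut10_ok
  · exact aut11_ok
  · exact aut12_ok
  · exact aut13_ok
  · exact aut14_ok
  · exact aut15_ok
  · exact aut16_ok
  · exact aut17_ok
  · exact aut18_ok
  · exact aut19_ok
  · exact aut20_ok
  · exact aut21_ok
  · exact aut22_ok
  · exact aut23_ok
  · exact aut24_ok
  · exact aut25_ok
  · exact aut26_ok
  · exact aut27_ok
  · exact aut28_ok
  · exact aut29_ok
  · exact aut30_ok
  · exact aut31_ok
  · exact aut32_ok
  · exact aut33_ok
  · exact aut34_ok
  · exact aut35_ok
  · exact aut36_ok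
  · exact aut37_ok
  · exact aut38_ok
  · exact aut39_ok
  · exact aut40_ok
  · exact aut41_ok
  · exact aut42_ok
  · exact aut43_ok
  · exact aut44_ok
  · exact aut45_ok
  · exact aut46_ok
  · exact aut47_ok
  · exact aut48_ok
  · exact aut49_ok
  · exact aut50_ok
  · exact aut51_ok
  · exact aut52_ok
  · exact aut53_ok
  · exact aut54_ok
  · exact aut55_ok
  · exact aut56_ok
  · exact aut57_ok
  · exact aut58_ok
  · exact aut59_ok
  · exact aut60_ok
  · exact aut61_ok
  · exact aut62_ok

end Summit.Ventures.QEC.Census.S8_126_w6_k12_01061B01
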